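import Mathlib.Topology.Algebra.Group.ClosedSubgroup
import Literature.AnabelianGeometry.SemiGraphs.HomComposition
import Literature.AnabelianGeometry.SemiGraphs.CommensurabilityProofs4
import Literature.AnabelianGeometry.Anabelioids.ExactFunctorProofs

/-!
# Locally open morphisms are stable under composition ([SemiAnbd] §2, Def 2.2 (ii) / Rmk 2.4.2) — merge step M3b, part 1

Mochizuki, *Semi-graphs of anabelioids*, Publ. RIMS **42** (2006), §2 Definition 2.2 (ii) p.24 and
Remark 2.4.2 p.26 (kurims `paper:url-f33ace170ff4`). [cite: MochizukiSemiAnbd2006, Def 2.2 (ii), p. 24]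

PROOF-ONLY bookkeeping toward the 1-category of Rmk 2.4.2 whose arrows are the LOCALLY OPEN
1-morphisms (the ambient category of §§4–5): the identity 1-morphism (`HomOver.id`,
`HomComposition.lean`) is locally open, and composites of locally open 1-morphisms (`Hom.comp`) are
locally open (`Hom.IsLocallyOpen` of `GraphOfAnabelioids.lean`: the induced homomorphisms of
fundamental groups of the constituent anabelioids have open image, for every basepoint).
Ingredients: functoriality of `pi1Map` in the 1-morphism (`pi1Map_comp`); an exact functor followed
by a fibre functor is a fibre functor (`fiberFunctor_comp_of_exact`, [SGA1] V 6.1, tree); and the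
topological-group fact that a continuous homomorphism between compact Hausdorff groups with open
image maps open subgroups to open subgroups (closed of finite index).  Nothing printed is re-typed.
-/

namespace Literature.AnabelianGeometry.SemiGraphs

open CategoryTheory CategoryTheory.PreGaloisCategory Literature.AnabelianGeometry.Anabelioids

universe v₁ u₁ u

/-! ### Topological groups: open subgroups go to open subgroups -/

section OpenImage

variable {B C : Type*} [Group B] [TopologicalSpace B] [IsTopologicalGroup B] [CompactSpace B]
  [Group C] [TopologicalSpace C] [IsTopologicalGroup C] [CompactSpace C] [T2Space C]

/-- A continuous homomorphism of compact Hausdorff groups with open image maps open subgroups to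
open subgroups (the image is compact, hence closed, and of finite index). [folklore] -/
private theorem isOpen_map_of_isOpen_range (g : B →* C) (hg : Continuous g)
    (hrange : IsOpen (Set.range g)) (U : Subgroup B) (hU : IsOpen (U : Set B)) :
    IsOpen (U.map g : Set C) := by
  -- finite index
  haveI : Finite (B ⧸ U) := Subgroup.quotient_finite_of_isOpen U hU
  haveI hUfi : U.FiniteIndex := Subgroup.finiteIndex_of_finite_quotient
  have hRopen : IsOpen (g.range : Set C) := by rwa [MonoidHom.coe_range]
  haveI : Finite (C ⧸ g.range) := Subgroup.quotient_finite_of_isOpen g.range hRopen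
  haveI hRfi : g.range.FiniteIndex := Subgroup.finiteIndex_of_finite_quotient
  haveI : (U ⊔ g.ker).FiniteIndex := Subgroup.finiteIndex_of_le le_sup_left
  haveI : (U.map g).FiniteIndex := ⟨by
    rw [Subgroup.index_map]
    exact mul_ne_zero Subgroup.FiniteIndex.index_ne_zero Subgroup.FiniteIndex.index_ne_zero⟩
  -- closed
  have hclosed : IsClosed (U.map g : Set C) := by
    rw [Subgroup.coe_map]
    exact ((Subgroup.isClosed_of_isOpen U hU).isCompact.image hg).isClosed
  exact Subgroup.isOpen_of_isClosed_of_finiteIndex _ hclosed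

end OpenImage

/-! ### Functoriality of `pi1Map` in the 1-morphism -/

section Pi1

variable {X : Type*} [Category X] {Y : Type*} [Category Y] {Z : Type*} [Category Z]

/-- `π₁` of a composite pull-back functor is the composite: `π₁(Q ⋙ P) = π₁(Q) ∘ π₁(P)` at the
basepoints `F`, `P ⋙ F`. [cite: MochizukiGeoAn2004, Def. 1.1.2(ii) p.10] -/
theorem pi1Map_comp (P : Y ⥤ X) (Q : Z ⥤ Y) (F : X ⥤ FintypeCat.{v₁}) :
    pi1Map (Q ⋙ P) F = (pi1Map Q (P ⋙ F)).comp (pi1Map P F) := by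
  ext σ T x
  rfl

/-- `π₁` of the identity pull-back functor is surjective (indeed the identity up to `𝟭 ⋙ F = F`).
[cite: MochizukiGeoAn2004, Def. 1.1.2(ii) p.10] -/
theorem pi1Map_id_surjective (F : X ⥤ FintypeCat.{v₁}) :
    Function.Surjective (pi1Map (𝟭 X) F) := by
  intro τ
  refine ⟨⟨⟨fun T => τ.hom.app T, fun _ _ f => τ.hom.naturality f⟩,
    ⟨fun T => τ.inv.app T, fun _ _ f => τ.inv.naturality f⟩, ?_, ?_⟩, ?_⟩
  · ext T x; exact congrFun (congrArg (fun q => (q.app T : _)) τ.hom_inv_id) x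
  · ext T x; exact congrFun (congrArg (fun q => (q.app T : _)) τ.inv_hom_id) x
  · rfl

end Pi1

namespace SemiGraphOfAnabelioids

variable {𝒢 ℋ 𝒦 : SemiGraphOfAnabelioids.{v₁, u₁, u}}

/-! ### The identity is locally open -/

/-- The identity 1-morphism is locally open. [cite: MochizukiSemiAnbd2006, Def 2.2 (ii), p. 24] -/
theorem Hom.id_isLocallyOpen (𝒢 : SemiGraphOfAnabelioids.{v₁, u₁, u}) : (Hom.id 𝒢).IsLocallyOpen := by
  refine ⟨fun v F _ => ?_, fun e F _ => ?_⟩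
  · have : Set.range (pi1Map ((Hom.id 𝒢).φV v).pullback F) = Set.univ :=
      Set.range_eq_univ.mpr (pi1Map_id_surjective F)
    rw [this]; exact isOpen_univ
  · have : Set.range (pi1Map ((Hom.id 𝒢).φE e ((Hom.id 𝒢).base.edgeMap e) rfl).pullback F) =
        Set.univ :=
      Set.range_eq_univ.mpr (pi1Map_id_surjective F)
    rw [this]; exact isOpen_univ

/-! ### Composites of locally open 1-morphisms are locally open -/

/-- The key step on one constituent: if `π₁(φ_c)` and `π₁(ψ_{c'})` have open image (the latter at
the basepoint `φ_c^* ⋙ F`, a basepoint by [SGA1] V 6.1), then `π₁(ψ_{c'} ∘ φ_c)` has open image.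
[cite: MochizukiSemiAnbd2006, Def 2.2 (ii), p. 24] -/
theorem isOpen_range_pi1Map_comp {A : Type u₁} [Category.{v₁} A] [GaloisCategory A]
    {B : Type u₁} [Category.{v₁} B] [GaloisCategory B] {C : Type u₁} [Category.{v₁} C]
    [GaloisCategory C] (φ : Anabelioids.Hom A B) (ψ : Anabelioids.Hom B C)
    (F : A ⥤ FintypeCat.{v₁}) [FiberFunctor F]
    (hφ : IsOpen (Set.range (pi1Map φ.pullback F)))
    (hψ : ∀ (F' : B ⥤ FintypeCat.{v₁}) [FiberFunctor F'], IsOpen (Set.range (pi1Map ψ.pullback F'))) :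
    IsOpen (Set.range (pi1Map (φ.comp ψ).pullback F)) := by
  haveI : FiberFunctor (φ.pullback ⋙ F) := fiberFunctor_comp_of_exact φ.pullback F
  have hset : Set.range (pi1Map (φ.comp ψ).pullback F) =
      ((pi1Map φ.pullback F).range.map (pi1Map ψ.pullback (φ.pullback ⋙ F)) :
        Set (Aut (ψ.pullback ⋙ φ.pullback ⋙ F))) := by
    ext τ
    constructor
    · rintro ⟨σ, rfl⟩
      exact ⟨pi1Map φ.pullback F σ, ⟨σ, rfl⟩, rfl⟩
    · rintro ⟨_, ⟨σ, rfl⟩, rfl⟩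
      exact ⟨σ, rfl⟩
  rw [hset]
  exact isOpen_map_of_isOpen_range _ (continuous_pi1Map ψ.pullback (φ.pullback ⋙ F))
    (hψ (φ.pullback ⋙ F)) _ (by rw [MonoidHom.coe_range]; exact hφ)

/-- **Composites of locally open 1-morphisms are locally open** (so that the locally open arrows
form a wide subcategory of the 1-category of Rmk 2.4.2). [cite: MochizukiSemiAnbd2006, Def 2.2 (ii), p. 24] -/
theorem Hom.IsLocallyOpen.comp {φ : Hom 𝒢 ℋ} {ψ : Hom ℋ 𝒦} (hφ : φ.IsLocallyOpen)
    (hψ : ψ.IsLocallyOpen) : (φ.comp ψ).IsLocallyOpen := by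
  refine ⟨fun v F _ => ?_, fun e F _ => ?_⟩
  · exact isOpen_range_pi1Map_comp (φ.φV v) (ψ.φV (φ.base.vertexMap v)) F (hφ.1 v F)
      (fun F' _ => hψ.1 (φ.base.vertexMap v) F')
  · exact isOpen_range_pi1Map_comp (φ.φE e (φ.base.edgeMap e) rfl)
      (ψ.φE (φ.base.edgeMap e) ((φ.comp ψ).base.edgeMap e) rfl) F (hφ.2 e F)
      (fun F' _ => hψ.2 (φ.base.edgeMap e) F')

end SemiGraphOfAnabelioids

end Literature.AnabelianGeometry.SemiGraphs
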